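import Mathlib
import HarnessLib

/-!
# LatticeQCDFlow / Scoring — the law of a pair of independent model draws with density `q`:
# `(q dμ) ⊗ (q dμ) = (q ⊗ q) d(μ ⊗ μ)`, and the integral / integrability dictionary

HONEST FRAMING: exact (Metropolis-corrected) sampling algorithms for lattice gauge theory;
figures of merit are autocorrelation/cost numbers at stated couplings and volumes; no
continuum-physics claim.

Venture `LatticeQCDFlow` (cell pub-lqcd), sub-topic `Scoring`; FANOUT row 3 (`s0-u1-a`, S0-B
implementation A, GEN-10).  Bookkeeping [folklore] over Mathlib (`prod_withDensity`,
`integral_withDensity_eq_integral_toReal_smul`, `integrable_withDensity_iff`), in the vocabulary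
of row 4's `Scoring/PairedDrawAcceptance` / `Scoring/AllPairsAcceptance` (a reference measure `μ`
on a measurable space `X`, a real density `q ≥ 0` entered as the `ℝ≥0∞`-density
`ENNReal.ofReal ∘ q`):
used by row 3's `Scoring/AllPairsAcceptanceVariance` to move Hoeffding's general-space variance
law (`Scoring/UStatisticVarianceIntegral`, stated for a common law `ν`) onto `ν = q dμ`.
NO definition is introduced.

* `withDensity_prod_withDensity_eq` — `(q dμ) ⊗ (q dμ) = (q ⊗ q) d(μ ⊗ μ)`;
* `integral_prod_withDensity_eq` — `∫ G d((q dμ) ⊗ (q dμ)) = ∫ G·(q ⊗ q) d(μ ⊗ μ)`,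
  `integrable_prod_withDensity_iff` — `G ∈ L¹((q dμ)⊗(q dμ)) ↔ G·(q ⊗ q) ∈ L¹(μ ⊗ μ)`;
* `integral_withDensity_eq'`, `integrable_withDensity_iff'` — the single-draw versions.

NOT CLAIMED: anything beyond bookkeeping.
-/

namespace Summit.Ventures.LatticeQCDFlow.Scoring.AllPairsVariance

open MeasureTheory

variable {X : Type*} [MeasurableSpace X] {μ : Measure X} [SFinite μ]

/-! ## §1 The model pair law `(q dμ) ⊗ (q dμ) = (q ⊗ q) d(μ ⊗ μ)` -/

/-- **The model pair law has density `q ⊗ q` w.r.t. `μ ⊗ μ`.** [folklore] -/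
theorem withDensity_prod_withDensity_eq {q : X → ℝ} (hq0 : ∀ y, 0 ≤ q y) (hqm : Measurable q) :
    (μ.withDensity fun y => ENNReal.ofReal (q y)).prod (μ.withDensity fun y => ENNReal.ofReal (q y))
      = (μ.prod μ).withDensity fun z => ENNReal.ofReal (q z.1 * q z.2) := by
  rw [prod_withDensity hqm.ennreal_ofReal hqm.ennreal_ofReal]
  congr 1
  funext z
  rw [ENNReal.ofReal_mul (hq0 _)]

/-- **Pair dictionary**: `∫ G d((q dμ) ⊗ (q dμ)) = ∫ G·(q ⊗ q) d(μ ⊗ μ)`. [folklore] -/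
theorem integral_prod_withDensity_eq {q : X → ℝ} (hq0 : ∀ y, 0 ≤ q y) (hqm : Measurable q)
    (G : X × X → ℝ) :
    ∫ z, G z ∂(μ.withDensity fun y => ENNReal.ofReal (q y)).prod
        (μ.withDensity fun y => ENNReal.ofReal (q y))
      = ∫ z, G z * (q z.1 * q z.2) ∂(μ.prod μ) := by
  have hdm : Measurable fun z : X × X => ENNReal.ofReal (q z.1 * q z.2) :=
    ((hqm.comp measurable_fst).mul (hqm.comp measurable_snd)).ennreal_ofReal
  rw [withDensity_prod_withDensity_eq hq0 hqm,
    integral_withDensity_eq_integral_toReal_smul hdm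
      (Filter.Eventually.of_forall fun _ => ENNReal.ofReal_lt_top)]
  refine integral_congr_ae (Filter.Eventually.of_forall fun z => ?_)
  simp only [ENNReal.toReal_ofReal (mul_nonneg (hq0 z.1) (hq0 z.2)), smul_eq_mul, mul_comm]

/-- **Pair dictionary, integrability**: `G ∈ L¹((q dμ) ⊗ (q dμ)) ↔ G·(q ⊗ q) ∈ L¹(μ ⊗ μ)` for
measurable `G`. [folklore] -/
theorem integrable_prod_withDensity_iff {q : X → ℝ} (hq0 : ∀ y, 0 ≤ q y) (hqm : Measurable q)
    (G : X × X → ℝ) :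
    Integrable G ((μ.withDensity fun y => ENNReal.ofReal (q y)).prod
        (μ.withDensity fun y => ENNReal.ofReal (q y)))
      ↔ Integrable (fun z => G z * (q z.1 * q z.2)) (μ.prod μ) := by
  have h : ∀ z : X × X, (ENNReal.ofReal (q z.1 * q z.2)).toReal = q z.1 * q z.2 := fun z =>
    ENNReal.toReal_ofReal (mul_nonneg (hq0 z.1) (hq0 z.2))
  have hdm : Measurable fun z : X × X => ENNReal.ofReal (q z.1 * q z.2) :=
    ((hqm.comp measurable_fst).mul (hqm.comp measurable_snd)).ennreal_ofReal
  rw [withDensity_prod_withDensity_eq hq0 hqm,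
    integrable_withDensity_iff hdm (Filter.Eventually.of_forall fun _ => ENNReal.ofReal_lt_top)]
  simp_rw [h]

omit [SFinite μ] in
/-- **Single-draw dictionary**: `∫ g d(q dμ) = ∫ g·q dμ`. [folklore] -/
theorem integral_withDensity_eq' {q : X → ℝ} (hq0 : ∀ y, 0 ≤ q y) (hqm : Measurable q)
    (g : X → ℝ) :
    ∫ y, g y ∂(μ.withDensity fun y => ENNReal.ofReal (q y)) = ∫ y, g y * q y ∂μ := by
  rw [integral_withDensity_eq_integral_toReal_smul hqm.ennreal_ofReal
      (Filter.Eventually.of_forall fun _ => ENNReal.ofReal_lt_top)]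
  refine integral_congr_ae (Filter.Eventually.of_forall fun y => ?_)
  simp only [ENNReal.toReal_ofReal (hq0 y), smul_eq_mul, mul_comm]

omit [SFinite μ] in
/-- **Single-draw dictionary, integrability**: `g ∈ L¹(q dμ) ↔ g·q ∈ L¹(μ)`. [folklore] -/
theorem integrable_withDensity_iff' {q : X → ℝ} (hq0 : ∀ y, 0 ≤ q y) (hqm : Measurable q)
    (g : X → ℝ) :
    Integrable g (μ.withDensity fun y => ENNReal.ofReal (q y))
      ↔ Integrable (fun y => g y * q y) μ := by
  have h : ∀ y, (ENNReal.ofReal (q y)).toReal = q y := fun y => ENNReal.toReal_ofReal (hq0 y)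
  rw [integrable_withDensity_iff hqm.ennreal_ofReal
      (Filter.Eventually.of_forall fun _ => ENNReal.ofReal_lt_top)]
  simp_rw [h]

end Summit.Ventures.LatticeQCDFlow.Scoring.AllPairsVariance
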